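import Summits.HodgeConjecture.HodgeConjecture.Theses.PadicSemiregularLift
import Summits.HodgeConjecture.HodgeConjecture.Theses.RankFourFaces
import Summits.HodgeConjecture.HodgeConjecture.Theorems.PadicSemiregularLiftHodgeAbelianVarietiesCMPivotBridgeItems
import Summits.HodgeConjecture.HodgeConjecture.Theorems.PadicSemiregularLiftHodgeAbelianVarietiesCMPivotAllFibres
import HarnessLib

/-!
# Crux `HodgeAbelianVarieties` (stmt-HodgeConjecture-1333), line `cm-pivot` gen 5 — the line's refinement of the transport item `CMToAbelian` (stmt-HodgeConjecture-16267), as an importable theorem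

Route `PadicSemiregularLift`, crux r4 `HodgeAbelianVarieties := ∀ A : AbelianVariety ℂ, HodgeConjectureFor A.dim A.X`
(the Hodge conjecture for every complex abelian variety). The line `cm-pivot` decomposes the crux into the two EXISTING
items stmt-3052 (`CMAbelianHodge`, HC for CM abelian varieties) and stmt-16267 (`RankFourFaces.CMToAbelian`, HC(CM) ⟹
HC for all abelian varieties) — an equivalence, `hodgeAbelianVarieties_iff_cmAbelianHodge_and_cmToAbelian`
(`…CMPivotConverseHolds`, p141892) — and gens 3–4 refined the TRANSPORT item into

* `NonCMDeepMiddleSections[]` — CM-anchored flat-SECTION data over the Hodge locus of a non-CM `(A, c)` in the deep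
  middle `dim A ≥ 4`, `2 ≤ p`, `2p ≤ dim A` (Deligne 1982 Prop. 6.1 (c) in its literal section form; TRUE IN PRINT:
  Shimura variety of `MT(A)` at neat level, Baily–Borel, Borel, maximal tori — or fine moduli `A_{g,d,n}` +
  Cattani–Deligne–Kaplan + a CM point; unformalised), and
* `LocalVHCAtCMDeepMiddleAll[]` — the local variational Hodge GERM at a CM fibre in the deep middle, with
  Hodge-ness of the global class on ALL fibres as hypothesis (OPEN: Grothendieck's variational Hodge conjecture for
  abelian schemes, localised; the graveyard of this crux's five dead transport lines).

Since 2026-08-17T04:54Z stmt-16267 has its own crux chain (`Cruxes/CMToAbelian/Lines/birth.lean`: stubs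
`stub_mumfordTateCMAnchors` — Deligne's Prop. 6.1 in GLOBAL-CLASS form, all fibres abelian — and `stub_abelianSchemeVHC`
— VHC for abelian schemes in global form, all `p`). This file makes the refinement importable for that chain
(sorry-free; local notations only, no definition, no named fact):

* `cmToAbelian_of_nonCMDeepMiddleSections_of_localVHCAtCMDeepMiddleAll` (REGISTERED composition sub-goal of
  stmt-1333) — **`NonCMDeepMiddleSections[] → LocalVHCAtCMDeepMiddleAll[] → RankFourFaces.CMToAbelian`**: feed the
  item's hypothesis `CMAbelianHodge` through the CM-typing bridge `hodgeCM_of_cmAbelianHodge` (`…CMPivotBridgeItems`,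
  p139146) into the landed all-fibres composition
  `AllFibres.hodgeAbelianVarieties_of_hodgeCM_of_nonCMDeepMiddleSections_of_localVHCAtCMDeepMiddleAll`
  (`…CMPivotAllFibres`: outside the deep middle HC is a theorem of the tree — Lefschetz `(1,1)`, hard Lefschetz,
  `dim ≤ 3`; a CM `A` is the hypothesis; for a non-CM `A` the section data is packaged into a global class by
  Deligne 1968 + the identity principle (`AllFibres.exists_globalClass_of_section`), algebraicity at the CM fibre comes
  from `CMAbelianHodge`, an open set of algebraic fibres from the germ, all fibres by Baire spreading with the THEOREM
  `charlesSchnell_algebraicityLocus_iUnion_closed_holds`).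

What the CMToAbelian chain gains: (i) its stub 2 (global VHC, arbitrary anchor, all `p`) may be weakened to a GERM
at a CM fibre in the deep middle `4 ≤ m`, `2 ≤ p ≤ m − 2`, provided its stub 1 records that the Mumford–Tate family
has quasi-projective base and total space (true: Baily–Borel / GIT 7.9–7.10); (ii) its stub 1 may be stated in
Deligne's literal flat-section form (c); the two CM typings of the tree agree (`isCM_iff_exists_cmSubalgebra`,
`…CMPivotConverseHolds`). HONEST STATUS: bookkeeping across two chains; no lever on either open half.
-/

set_option linter.dupNamespace false

noncomputable section

open CategoryTheory
open Literature.AlgebraicGeometry Literature.AlgebraicGeometry.Motives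

namespace Summit.HodgeConjecture.HodgeConjecture.Theorems.HodgeAbelianVarieties.CMPivot

/-! ### Statements (local notations, verbatim from `Lines/cm_pivot.lean` gen 4–5 and the landed helper files) -/

/-- `IsCM[A]` — CM type: an endomorphism with `2 · dim A` distinct eigenvalues on `H¹(A(ℂ); ℂ)`
(verbatim the gallery line's notation). Local notation only. -/
local notation3 (prettyPrint := false) "IsCM[" A "]" =>
  ∃ (ψ : A ⟶ A) (μ : Fin (2 * AbelianVariety.dim A) → ℂ), Function.Injective μ ∧
    ∀ i, Module.End.HasEigenvalue (HodgeTheory.complexBetti.map ψ.hom.hom.hom 1).hom (μ i)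

/-- `QProj[X]` — `X` is quasi-projective over `ℂ`: INLINED body of
`HodgeTheory.IsQuasiProjectiveOver X` (the route file does not import its home module). Local notation only. -/
local notation3 (prettyPrint := false) "QProj[" X "]" =>
  ∃ (P : SchemeOver ℂ) (j : X ⟶ P), IsProjectiveOver P ∧ AlgebraicGeometry.IsOpenImmersion j.left

/-- `FibreIncl[f, B, e, s]` — `e` presents `B` as THE fibre of `f` over `s` (`≫` spelled out). Local notation only. -/
local notation3 (prettyPrint := false) "FibreIncl[" f ", " B ", " e ", " s "]" =>
  ∃ i : AbelianVariety.X B ≅ fiberOver f s, e = CategoryStruct.comp i.hom (fiberι f s)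

/-- `HodgeAlongAll[S, f, G, m, p]` — the global class `G ∈ H^{2p}(𝒳(ℂ); ℂ)` restricts to a RATIONAL class of
Hodge type `(p,p)` (for dimension `m`) on EVERY fibre `𝒳_u` (not only on abelian-presented ones). Local notation only. -/
local notation3 (prettyPrint := false) "HodgeAlongAll[" S ", " f ", " G ", " m ", " p "]" =>
  ∀ u : ComplexPoints S,
    HodgeTheory.IsRationalClass (HodgeTheory.complexBetti.map (fiberι f u) (2 * p) G) ∧
    HodgeTheory.IsOfHodgeType m (fiberOver f u) (2 * p) p p (HodgeTheory.complexBetti.map (fiberι f u) (2 * p) G)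

/-- `LocalVHCAtCMDeepMiddleAll[]` — the DEEP-MIDDLE part of `LocalVHCAtCMAll[]`: three guards `4 ≤ m → 2 ≤ p →
p + 2 ≤ m →` after the binders, everything else byte-identical. Local notation only. -/
local notation3 (prettyPrint := false) "LocalVHCAtCMDeepMiddleAll[]" =>
  ∀ (S 𝒳 : SchemeOver ℂ) (f : 𝒳 ⟶ S) (m p : ℕ) (G : HodgeTheory.complexBetti 𝒳 (2 * p))
    (s₀ : ComplexPoints S) (A₀ : AbelianVariety ℂ) (e₀ : A₀.X ⟶ 𝒳),
    4 ≤ m → 2 ≤ p → p + 2 ≤ m →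
    QProj[𝒳] → QProj[S] → AlgebraicGeometry.Smooth S.hom → IrreducibleSpace S.left →
    IsSmoothProjectiveFamily f m →
    FibreIncl[f, A₀, e₀, s₀] → IsCM[A₀] →
    HodgeTheory.complexBetti.map e₀ (2 * p) G ∈ HodgeTheory.algebraicClasses A₀.X p →
    HodgeAlongAll[S, f, G, m, p] →
    ∃ U : Set (ComplexPoints S), IsOpen U ∧ s₀ ∈ U ∧ ∀ t ∈ U,
      HodgeTheory.complexBetti.map (fiberι f t) (2 * p) G ∈
        HodgeTheory.algebraicClasses (fiberOver f t) p

/-- `NonCMDeepMiddleSections[]` — CM-anchored SECTION data over the Hodge locus for a NON-CM abelian variety of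
dimension `≥ 4` and a rational `(p,p)` class in the deep middle `2 ≤ p`, `2p ≤ dim A` (the landed helper file's
`NonCMSections[]`, `Theorems/PadicSemiregularLiftHodgeAbelianVarietiesCMPivotStubCmAnchoredFamilies.lean`, p137954,
with the three guards `4 ≤ A.dim →`, `2 ≤ p →`, `2 * p ≤ A.dim →` inserted; outside the deep middle HC is a theorem
of the tree, `Unconditional.hodgeAbelianVarieties_iff_four_le_dim_holds`, so no packaging is needed there). In print:
the universal family over the fine moduli scheme `A_{g,d,n}`, the Hodge-locus component through `(A, c)`
(Cattani–Deligne–Kaplan 1995), a CM point on it (Mumford 1969 / Deligne 1982), the tautological flat section.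
Local notation only. [cite: CattaniDeligneKaplan1995JAMS, Thm. 1.1 and Cor. 1.2] [cite: GreenGriffithsKerr2012, Lemma (VI.C.1)] -/
local notation3 (prettyPrint := false) "NonCMDeepMiddleSections[]" =>
  ∀ (A : AbelianVariety ℂ), ¬ IsCM[A] → 4 ≤ A.dim → ∀ (p : ℕ) (c : HodgeTheory.complexBetti A.X (2 * p)),
    2 ≤ p → 2 * p ≤ A.dim →
    HodgeTheory.IsRationalClass c → HodgeTheory.IsOfHodgeType A.dim A.X (2 * p) p p c →
    ∃ (S 𝒳 : SchemeOver ℂ) (f : 𝒳 ⟶ S) (t s₀ : ComplexPoints S) (i : A.X ≅ fiberOver f t)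
      (A₀ : AbelianVariety ℂ) (e₀ : A₀.X ⟶ 𝒳) (σ : ComplexPoints S → HodgeTheory.FiberClass f (2 * p)),
      QProj[𝒳] ∧ QProj[S] ∧ AlgebraicGeometry.Smooth S.hom ∧ IrreducibleSpace S.left ∧
      IsSmoothProjectiveFamily f A.dim ∧
      FibreIncl[f, A₀, e₀, s₀] ∧ IsCM[A₀] ∧
      Continuous σ ∧ (∀ s, (σ s).pt = s) ∧
      (∀ s, σ s ∈ HodgeTheory.locusOfHodgeClasses f A.dim p) ∧
      σ t = ⟨t, HodgeTheory.complexBetti.map i.inv (2 * p) c⟩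

/-- `CMToAbelian[]` — VERBATIM the signature of the existing item `CMToAbelian` (stmt-HodgeConjecture-16267;
`Theses.RankFourFaces`, the unqualified `CMAbelianHodge` of the item's signature resolving to
`RankFourFaces.CMAbelianHodge`): HC for CM abelian varieties implies HC for every complex abelian variety.
(`Iff.rfl`-equal to `Summit.HodgeConjecture.HodgeConjecture.Theses.RankFourFaces.CMToAbelian`.) Local notation only. -/
local notation3 (prettyPrint := false) "CMToAbelian[]" =>
  Summit.HodgeConjecture.HodgeConjecture.Theses.RankFourFaces.CMAbelianHodge → ∀ (A : Literature.AlgebraicGeometry.Motives.AbelianVariety ℂ), Literature.AlgebraicGeometry.Motives.IsSmoothProjective A.dim A.X → Literature.AlgebraicGeometry.HodgeTheory.HodgeConjectureFor A.dim A.X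

/-! ### The refinement of stmt-16267 carried by the line `cm-pivot` -/

/-- **Registered composition sub-goal `cmToAbelian_of_nonCMDeepMiddleSections_of_localVHCAtCMDeepMiddleAll`** —
CM-anchored SECTION data over the Hodge locus of every non-CM `(A, c)` in the deep middle (`NonCMDeepMiddleSections[]`,
Deligne 1982 Prop. 6.1 (c) in section form — print) and the local variational Hodge GERM at a CM fibre in the deep
middle with Hodge-ness on all fibres (`LocalVHCAtCMDeepMiddleAll[]` — open) imply the existing item
`RankFourFaces.CMToAbelian` (stmt-HodgeConjecture-16267): the item's hypothesis `CMAbelianHodge` gives child 1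
`HodgeCM[]` by the bridge `hodgeCM_of_cmAbelianHodge`, and the landed all-fibres composition
`AllFibres.hodgeAbelianVarieties_of_hodgeCM_of_nonCMDeepMiddleSections_of_localVHCAtCMDeepMiddleAll` gives HC for
every complex abelian variety (the smooth-projectivity hypothesis of the item is not even needed:
`AbelianVariety.isSmoothProjective_holds`). [cite: Deligne1982HodgeCycles, Prop. 6.1]
[cite: BlochEsnaultKerz2014CharZero, appendix] [cite: CharlesSchnell2014Notes, Prop. 11.3.5 and Thm. 11.5.11] -/
theorem cmToAbelian_of_nonCMDeepMiddleSections_of_localVHCAtCMDeepMiddleAll : NonCMDeepMiddleSections[] → LocalVHCAtCMDeepMiddleAll[] → CMToAbelian[] :=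
  fun h₂ h₃ h₁ A _ =>
    Summit.HodgeConjecture.HodgeConjecture.Cruxes.HodgeAbelianVarieties.CMPivot.AllFibres.hodgeAbelianVarieties_of_hodgeCM_of_nonCMDeepMiddleSections_of_localVHCAtCMDeepMiddleAll
      (hodgeCM_of_cmAbelianHodge h₁) h₂ h₃ A

/-- The same, concluding the route decl `RankFourFaces.CMToAbelian` by NAME (for the CMToAbelian chain's
composition). [cite: Deligne1982HodgeCycles, Prop. 6.1] [cite: BlochEsnaultKerz2014CharZero, appendix] -/
theorem cmToAbelian_of_nonCMDeepMiddleSections_of_localVHCAtCMDeepMiddleAll'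
    (h₂ : NonCMDeepMiddleSections[]) (h₃ : LocalVHCAtCMDeepMiddleAll[]) :
    Summit.HodgeConjecture.HodgeConjecture.Theses.RankFourFaces.CMToAbelian :=
  cmToAbelian_of_nonCMDeepMiddleSections_of_localVHCAtCMDeepMiddleAll h₂ h₃

/-- Upper bound (sanity): granting abelian presentations of all fibres (GIT 6.14, HYPOTHESIS `hAV`, verbatim
`AbelianFibres[]` of `…CMPivotAllFibres`), the germ antecedent is itself implied by the two items stmt-3052 ∧
stmt-16267 (through the crux: `hodgeAbelianVarieties_of_cmAbelianHodge_of_cmToAbelian` and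
`AllFibres.localVHCAtCMAll_of_hodgeAbelianVarieties`), so the refinement asks no more than the item it refines plus
the print packaging. [cite: MumfordFogartyKirwan1994, Ch. 6 §1 Thm. 6.14] -/
theorem localVHCAtCMDeepMiddleAll_of_cmAbelianHodge_of_cmToAbelian
    (h₁ : Summit.HodgeConjecture.HodgeConjecture.Theses.RankFourFaces.CMAbelianHodge) (h₂ : CMToAbelian[])
    (hAV : ∀ (S 𝒳 : SchemeOver ℂ) (f : 𝒳 ⟶ S) (m : ℕ) (s₀ : ComplexPoints S) (A₀ : AbelianVariety ℂ)
      (e₀ : A₀.X ⟶ 𝒳), QProj[𝒳] → QProj[S] → AlgebraicGeometry.Smooth S.hom → IrreducibleSpace S.left →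
      IsSmoothProjectiveFamily f m → FibreIncl[f, A₀, e₀, s₀] →
      ∀ t : ComplexPoints S, ∃ (B : AbelianVariety ℂ) (eB : B.X ⟶ 𝒳), FibreIncl[f, B, eB, t]) :
    LocalVHCAtCMDeepMiddleAll[] :=
  fun S 𝒳 f m p G s₀ A₀ e₀ _ _ _ =>
    Summit.HodgeConjecture.HodgeConjecture.Cruxes.HodgeAbelianVarieties.CMPivot.AllFibres.localVHCAtCMAll_of_hodgeAbelianVarieties
      (hodgeAbelianVarieties_of_cmAbelianHodge_of_cmToAbelian h₁ h₂) hAV S 𝒳 f m p G s₀ A₀ e₀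

end Summit.HodgeConjecture.HodgeConjecture.Theorems.HodgeAbelianVarieties.CMPivot

end
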